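import Summits.QuantumFields.YangMills.Theorems.BalabanUVNodesN07SymHQnear
import Summits.QuantumFields.YangMills.Theorems.BalabanUVNodesN07SymNearRowsQAB
import Literature.MathematicalPhysics.QuantumFieldTheory.Balaban1983to89.Node00.CriticalOnFibreTopGuardedBPrint
import HarnessLib

/-!
# N07 [B11] (= [15] = [Balaban1985Variational]) Sect. F — MODULE 99″ (E-edition; plan g93 A3⁵ ∕ director №311a (β), chart side (III)-5): **(c′) DISCHARGED IN BINDER FORM UNDER THE — **PRINT-DATUM EDITION (B)**
# φ-b₂ PREMISE WITH A LEVEL-DEPENDENT DEFECT** — the (c′) letter `hQnear` of 89⁵∕90⁵ (at `NrmSymPhiOfRecord … (Ψ ε j)`) PROVED from the K0 assembler's numerics at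
# `β₁ ε δ j := L·(2·(X₀′·δ_j + Ω_j·(1 + X₀′·δ_j)) + 64·60800·ℓ²·(κ·ε_j·L)²)`, `Ω_j = ω_j + ω_j + ω_j²`, `ω_j = φ_j + 6Ψ ε j + 6φ_j·Ψ ε j`, `φ_j = 100·(240ℓ²κε_jL)²` — MODULE 99 re-cut:
# the adapter from the binder's prefix to MODULE 98′ (instantiated at the scalar `ψ := Ψ ε j`); `Adm22 D″ R (L·M_h)` is the NON-widened named instance
# `adm22_meetCube_trunc_seqOfRecord`; when `Ψ ε j ≤ ψc·(κε_j)²` every non-δ part of `β₁` is ε²-type (the `Q·ε_j²` slot; (Q-ψ₂) YES; n07-e ⚑ I.30825)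

PRINT-DATUM TWIN (FLAG №16 ∕ LOCATE-HSEAM 5d3298b8d191f169; S1c∕C2 of the (E1)∕(iii-b) work plan, director-ym №338∕№339) of `…N07SymHQnear.hQnear_symPhiE_of_guards`, which stays landed and
true on its own text; this file is the SAME text with the binder's data row `Sect2.DataSmall7PTop (avOfRecord F N K) s.Ω (suppDom) k δ W` ↦ `dataSmall7LamTopOf F N K s.Ω (suppDom) k δ W`
(P0 `Node00/CriticalOnFibreTopGuardedBPrint`, = §7′'s `Sect2.DataSmall7LamTop (avOfRecord F N K) …` by `rfl`; [15] (7) p. 278 L20–33 on print's ranges) and its fibre rows `AgreeOn (genSet s.Ω k) (Ū U) W →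
IsCritOnFibre F N K (genSet s.Ω k) W U` ↦ `AgreeOnB (lamDatum F K k s.Ω) (Ū U) W → IsCritOnFibreB F N K (lamDatum F K k s.Ω) W U` (F0c; `lamDatum F K k s.Ω = lamBondsSeq s.Ω k` by `rfl`; [II]
(2.3) «Λ_j = Ω_j^{(j)} ∖ Ω_{j+1}^{(j)} … for the sets of sites and the sets of bonds», p. 224; ruling (α) of record: the DIFFERENCE of the bond sets — inward connectors belong to no `Λ_j`) —
i.e. EXACTLY the (c′) binder `hQnear` of 89⁵′ (`…ChartMeetNorm77OfLettersSym152EB`, ✓p766239) at `bd := lamDatum F`, `Dat := dataSmall7LamTopOf F N`; MODULE 98′ replaced by its print-datum twin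
`…SymNearRowsQAB.norm_bondAvgIter_le_of_near_symPhiB` (fed by `…SymNearRows{Top,Dent}B` ← `…PrintWindowDataSmallB` ∕ `…DentDataSmallB` ← `…ChartTopBoxPlaquettesB`); no other displayed premise is
deleted or weakened; SAME `β₁`, same numeric guards; proof = the parent's bytes with one name swapped (the criticality row is threaded, never read).  Seat `pub-ymgap-dag-n07-e` g34;
`--kind proof --supports stmt-QuantumFields-20541 --as helper` (K0⁷); count-neutral; def-free; `maxHeartbeats 800000` as in the parent (the β₁ polynomial).
HONEST SCOPE.  (c′) at print's datum is thereby DISCHARGED in binder form exactly as 99″ discharged it at the (b)-datum — from the data and the fibre near the cube; nothing of [15]∕[6]∕[3]∕[II]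
asserted anew; K0⁷ ∕ K1⁹ NOT closed; N07 NOT discharged; counts unmoved (typed 28∕28 · discharged 8∕28); one finite 𝕋⁴ programme at fixed ε — the route closes the conditional finite-𝕋⁴ rung
`BalabanLadder.UV` ONLY; the YM mass gap (Clay) is NOT proved by any of this; nothing continuum ∕ ℝ⁴ ∕ OS.  No `sorry`, no `def`, no `instance`, no `notation`.  PARENT's HEADER FOLLOWS (its theorem
name carries the suffix `B` here).

Cell `pub-ymgap`, seat `pub-ymgap-dag-n07-e` g30 (FAN-OUT §N07 row s3; LANE OWNER of the K0 road chart side).  `--kind proof --supports stmt-QuantumFields-20541 --as helper` (K0⁷);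
count-neutral; ONE theorem (0 `def`).  [15] = [Balaban1985Variational]; [3] = [Balaban1985Averaging]; [6] = [Balaban1985RegularSpaces]; [4] = [Balaban1984PropagatorsII]; [I] = [Balaban1987RG1].

WHAT IS PROVED (sorry-free; axioms standard).  ★★★ `hQnear_symPhiE_of_guards (F N)`: under the structural letters of 90⁵, any guard `Adm` with the two displayed consequences,
`2L ≤ R·(L·M_h) + 1`, `0 < B₃`, `0 ≤ κ`, the numeric guards on `a₀` (`243200·ℓ²·κ·L·a₀ ≤ 1`, `60·ℓ²·κLa₀ < δ_N`, `5760ℓ²κLa₀ < δ_F`, `2880ℓ²κLa₀ < δ_N`, `240ℓ²κLa₀ ≤ 10⁻⁴`), on `a₁`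
(MODULE 68's `δ_N`-guard, the sym within-block guard), and the per-level defect guards `0 ≤ Ψ ε j ≤ 1∕32`, `X₀′·a₁ + 2Ω_j ≤ ½` (for `0 ≤ ε_j ≤ a₀`) — the `hQnear` binder of 89⁵∕90⁵ HOLDS
at the displayed `β₁` (`ℓ = 6L`, `d = 4`).
HONEST SCOPE: by-name composition (MODULE 98′ + bookkeeping); the guards are the K0 assembler's numerics; `NrmSymPhiOfRecord` arrives through the binder (CONDITIONAL premise
`HThm4RecSym152PhiE`, N05's (B′) road — UNDISCHARGED); HSEAM and the budget row remain the token's displayed hypotheses ((d′)-Lam is ✓p741304); nothing of [15]∕[6]∕[3] ANALYSIS asserted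
beyond the cited lemmas; K0⁷ NOT closed; N07 NOT discharged; counts unmoved; one finite 𝕋⁴ programme at fixed ε — the route closes the conditional finite-𝕋⁴ rung `BalabanLadder.UV`
ONLY; the YM mass gap (Clay) is NOT proved by any of this; nothing continuum ∕ ℝ⁴ ∕ OS.  No `def`, no `instance`, no `notation`, no `sorry`.

References: [15] (144) p. 300, (147)–(157) pp. 301–302, (160) p. 303, (163) p. 304; [3] (26) p. 22, (78)–(81) p. 30, Prop. 4 (134)–(135) p. 38; [6] Lemma 1 (1.25) p. 79, p. 98,
(1.131) p. 99; [4] (2.1)–(2.3) p. 224; [I] (0.4), (0.6), (0.11) p. 253.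
-/

set_option autoImplicit false

noncomputable section

open scoped BigOperators Matrix.Norms.L2Operator

namespace Summit.QuantumFields.YangMills.BalabanUVNodes.N07SymHQnearPhiEB

open Literature.MathematicalPhysics.QuantumFieldTheory.Balaban1983to89
open Literature.MathematicalPhysics.QuantumFieldTheory.Balaban1983to89.Node00
open Literature.MathematicalPhysics.QuantumFieldTheory.Balaban1983to89.B15DeterminingSets
open Literature.MathematicalPhysics.QuantumFieldTheory.Balaban1983to89.B15DeterminingSetsB
open Literature.MathematicalPhysics.QuantumFieldTheory.Balaban1983to89.B12RegularSpaces111 (gaugeU expI grad)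
open LatticeFieldCalculus (bondAvgIter)
open B15Eq112TorusCover (cover)
open B14DomainGeom (Pt Within)
open B5Eq118OneStroke (iterBlockOf)
open B8Eq131Cubes (sqLo sqHi box cube tLo tHi crad)
open B6SectADomainsV1 (Domains)
open B6SectAOperatorsV1 (BondIdx RE dsE QpE)
open Literature.MathematicalPhysics.QuantumFieldTheory.BalabanImbrieJaffe1984to88.BIJ85AxialPropagator411 (BondSpace)
open T4Continuum (T4Family)
open GaugeField (gaugeAct)
open ExpMeanLog (deltaSU)
open FederbushMean (federbushSU deltaFed)
open Summit.QuantumFields.YangMills.Theorems.FlatCubeOpsText (Adm22)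
open Summit.QuantumFields.YangMills.BalabanUVNodes.N07Thm4RecordStructureSym152Phi (NrmSymPhiOfRecord)
open Summit.QuantumFields.YangMills.BalabanUVNodes.N07MeetFamilyAtRecord (adm22_meetCube_trunc_seqOfRecord)
open Summit.QuantumFields.YangMills.BalabanUVNodes.N07SymNearRowsQAPhiB (norm_bondAvgIter_le_of_near_symPhiB)
open Summit.QuantumFields.YangMills.BalabanUVNodes.N07DatumGauge152Guarded (numerics_cornerP_of_levelGuard two_mul_pow_le_sitesPerDir_of_levelGuard)

/-! ## §2  (c′) in binder form -/

section Record

variable (F : T4Family) (N : ℕ) [NeZero N]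

set_option maxHeartbeats 800000 in
/-- ★★★ **(c′) IN BINDER FORM, LEVEL-DEPENDENT DEFECT, AT PRINT's [II] (2.3) DATUM AND PRINT's (7) DATA** — print-datum twin of `hQnear_symPhiE_of_guards` (FLAG №16 ∕ LOCATE-HSEAM
5d3298b8d191f169; the (b)-instance stays landed and true on its own text); the binder's data row is `dataSmall7LamTopOf F N K s.Ω (suppDom) k δ W` (P0) and its fibre rows are
`AgreeOnB (lamDatum F K k s.Ω) (Ū U) W → IsCritOnFibreB F N K (lamDatum F K k s.Ω) W U` (F0c) — exactly 89⁵′'s (c′) binder at `bd := lamDatum F`, `Dat := dataSmall7LamTopOf F N`; SAME `β₁`, same guards: the `hQnear` letter of 89⁵∕90⁵ at the displayed `β₁`, from the structural letters, the guard `Adm`'s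
two consequences, the numeric guards on `a₀`, `a₁` and the per-level defect guards.
[cite: Balaban1985Variational, (152)–(157) pp.301–302, (160) p.303, (163) p.304, (144) p.300, (147)–(150) p.301; Balaban1985Averaging, (26) p.22, (78)–(81) p.30, Prop. 4 (134)–(135) p.38; Balaban1985RegularSpaces, Lemma 1 (1.25) p.79, p.98, (1.131) p.99; Balaban1984PropagatorsII, (2.1)–(2.3) p.224; Balaban1987RG1, (0.6), (0.11) p.253] -/
theorem hQnear_symPhiEB_of_guards
    {ρ Mc Mh R a' c c₀ : ℕ} (hMc : 1 ≤ Mc) (hMha : Mh = F.L ^ a') (hdvd : F.L * Mh ∣ ρ) (hRρ : R * (F.L * Mh) ≤ ρ) (hLρ : F.L ≤ ρ)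
    (hcfl : (11 * 4 + 4 * ρ + Mc + 3) * F.L ≤ c) (hc₀ : Mc + 11 * 4 + 6 * ρ + 1 ≤ 2 * F.L ^ c₀) (hac₀ : a' + 3 ≤ c₀)
    (Adm : StepGuard F) (hAdm₁ : ∀ (ν : Stage7Numerics) (M : ℕ) (g : ℕ → ℝ) (K k : ℕ) (s : SeqOfRecord F ν M g K k), Adm ν M g K k s → c ≤ ν.M₁ ∧ k + c₀ ≤ F.m + K)
    (hAdm₂ : ∀ (ν : Stage7Numerics) (M : ℕ) (g : ℕ → ℝ) (K k : ℕ) (s : SeqOfRecord F ν M g K k), Adm ν M g K k s → ∀ j : ℕ, 1 ≤ j → j ≤ k →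
      F.L * Mh ∣ M * RkOfRecord (F.P K).L ν.r (g j) ∧ dCubeSide (F.P K).L M (RkOfRecord (F.P K).L ν.r (g j)) j ∣ (F.P K).sitesPerDir 0)
    (hRM : 2 * F.L ≤ R * (F.L * Mh) + 1)
    {B₃ κ a₀ a₁ : ℝ} {Ψ : (ℕ → ℝ) → ℕ → ℝ} (hB₃ : 0 < B₃) (hκ : 0 ≤ κ)
    -- the numeric guards (the K0 assembler's choice of `a₀`, `a₁` after `ρ`, `Mc`, `κ`; `ψ = ψ₂`)
    (ha₀bud : 243200 * (((4 + 2) * F.L : ℕ) : ℝ) ^ 2 * (κ * a₀ * (F.L : ℝ)) ≤ 1)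
    (ha₀gd : 60 * (((4 + 2) * F.L : ℕ) : ℝ) ^ 2 * (κ * a₀ * (F.L : ℝ)) < deltaSU (Fin N))
    (ha₀σF : 5760 * (((4 + 2) * F.L : ℕ) : ℝ) ^ 2 * (κ * a₀ * (F.L : ℝ)) < deltaFed (Fin N))
    (ha₀σS : 2880 * (((4 + 2) * F.L : ℕ) : ℝ) ^ 2 * (κ * a₀ * (F.L : ℝ)) < deltaSU (Fin N))
    (ha₀σ4 : 240 * (((4 + 2) * F.L : ℕ) : ℝ) ^ 2 * (κ * a₀ * (F.L : ℝ)) ≤ 1 / 10000)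
    (hguard : ((((4 + 2) * F.L : ℕ) : ℝ) ^ 2 / 4) * ((4 * (((4 - 1 : ℕ) : ℝ) * ((2 * F.L - 1 : ℕ) : ℝ)) + 1) * a₁) < deltaSU (Fin N))
    (hguardF : 2 * (((4 * ((F.L - 1) / 2) : ℕ) : ℝ) * ((((4 - 1 : ℕ) : ℝ) * ((F.L - 1 : ℕ) : ℝ)) * a₁)) < (federbushSU (n := Fin N)).δ)
    -- ★ THE DEFECT's GUARDS, per level: sign, size (`≤ 1∕32`) and the range `X₀′·a₁ + 2Ω_j ≤ ½` (K0 numerics; `Ψ ε j = ψ₂` is ε²-type)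
    (hΨ : ∀ (ε : ℕ → ℝ) (j : ℕ), 0 ≤ ε j → ε j ≤ a₀ → 0 ≤ Ψ ε j ∧ Ψ ε j ≤ 1 / 32 ∧
      (((4 - 1 : ℕ) : ℝ) * ((crad (ρ * ((Mc + 11 * 4) / ρ + 2)) ρ : ℕ) : ℝ) * (1 + 2 * (((F.L : ℝ) ^ 2 + 6 * (((4 + 2) * F.L : ℕ) : ℝ) ^ 2) * (4 * (((4 - 1 : ℕ) : ℝ) * ((2 * F.L - 1 : ℕ) : ℝ)) + 1))) + 14 * ((((4 + 2) * F.L : ℕ) : ℝ) ^ 2 / 4 * (4 * (((4 - 1 : ℕ) : ℝ) * ((2 * F.L - 1 : ℕ) : ℝ)) + 1)) + 2 * (((4 + 1) * (F.L - 1) : ℕ) : ℝ) * ((((14 * (4 * ((F.L - 1) / 2)) + 1 : ℕ) : ℝ)) * (((4 - 1 : ℕ) : ℝ) * ((F.L - 1 : ℕ) : ℝ)))) * a₁ +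
        2 * ((100 * (240 * (((4 + 2) * F.L : ℕ) : ℝ) ^ 2 * (κ * ε j * (F.L : ℝ))) ^ 2 + 6 * Ψ ε j + 100 * (240 * (((4 + 2) * F.L : ℕ) : ℝ) ^ 2 * (κ * ε j * (F.L : ℝ))) ^ 2 * (6 * Ψ ε j)) + (100 * (240 * (((4 + 2) * F.L : ℕ) : ℝ) ^ 2 * (κ * ε j * (F.L : ℝ))) ^ 2 + 6 * Ψ ε j + 100 * (240 * (((4 + 2) * F.L : ℕ) : ℝ) ^ 2 * (κ * ε j * (F.L : ℝ))) ^ 2 * (6 * Ψ ε j)) + (100 * (240 * (((4 + 2) * F.L : ℕ) : ℝ) ^ 2 * (κ * ε j * (F.L : ℝ))) ^ 2 + 6 * Ψ ε j + 100 * (240 * (((4 + 2) * F.L : ℕ) : ℝ) ^ 2 * (κ * ε j * (F.L : ℝ))) ^ 2 * (6 * Ψ ε j)) * (100 * (240 * (((4 + 2) * F.L : ℕ) : ℝ) ^ 2 * (κ * ε j * (F.L : ℝ))) ^ 2 + 6 * Ψ ε j + 100 * (240 * (((4 + 2) * F.L : ℕ) : ℝ) ^ 2 * (κ * ε j * (F.L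 : ℝ))) ^ 2 * (6 * Ψ ε j))) ≤ 1 / 2) :
        ∀ (ν : Stage7Numerics) (M : ℕ) (g : ℕ → ℝ) (K k : ℕ) (s : SeqOfRecord F ν M g K k), Sect2.SeqSeparated ν.M₁ s → 0 < ν.M₁ →
      Adm ν M g K k s → 1 ≤ k →
      ∀ (ε δ : ℕ → ℝ),
      (∀ n, n ≤ k → 0 < δ n ∧ δ n ≤ a₁) → (∀ n, n < k → δ n ≤ 2 * δ (n + 1)) → (∀ n, n < k → δ (n + 1) ≤ 2 * δ n) →
      (∀ n, n ≤ k → B₃ * δ n ≤ ε n ∧ ε n ≤ a₀) → (∀ n, n < k → ε n ≤ 2 * ε (n + 1)) → (∀ n, n < k → ε (n + 1) ≤ 2 * ε n) →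
      ∀ W : MSField (F.P K) (SU N), dataSmall7LamTopOf F N K s.Ω (suppDomOfRecord F ν K s.Ω) k δ W →
      ∀ U : GaugeField (F.P K) 0 (SU N),
      (∀ n, n ≤ k → PlaqSmallOn (Sect2.omegaPlaqsTop s.Ω (suppDomOfRecord F ν K s.Ω) n) (ε n * (F.P K).eta n ^ 2) U) →
      (∀ n, n ≤ k → Sect2.CoDivSmallOn (Sect2.omegaBondsTop s.Ω (suppDomOfRecord F ν K s.Ω) n) (ε n * (F.P K).eta n ^ 3) U) →
      AgreeOnB (lamDatum F K k s.Ω) (avgFamily (avOfRecord F N K) U) W → IsCritOnFibreB F N K (lamDatum F K k s.Ω) W U →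
      ∀ (n : ℕ) (hk : K - n ≤ (F.P K).m + (F.P K).K), 1 ≤ K - n → K - n ≤ k → ∀ (idx : Pt (F.P K).d),
      -- MEETING DATUMS ONLY: the print box has a point within `3` of a lift of a site of `Ω_{K−n}`
      (∃ x ∈ box (F.P K).L (cornerP (F.P K) Mc ρ idx) (sideP (F.P K) Mc ρ) (K - n), ∃ y : Pt (F.P K).d, cover (F.P K) y ∈ s.Ω (K - n) ∧ Within ((3 : ℕ) : ℤ) x y) →
      -- PRINT-MARGIN-CLEAN DATUMS ONLY (print p. 300 + (144)'s margin cube «□̃» = the print box WIDENED BY `2ρ` BLOCKS): top level, or «□̃» misses `Ω_{j+1}`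
      (K - n = k ∨ ∀ z ∈ box (F.P K).L (cornerP (F.P K) Mc ρ idx - ((2 * ρ : ℕ) : Pt (F.P K).d)) (sideP (F.P K) Mc ρ + 2 * (2 * ρ)) (K - n),
        cover (F.P K) z ∉ s.Ω (K - n + 1)) →
      -- THE FAMILY: print's (150) `Ω′_j = □_j (j < k), Ω′_k = □_k ∩ Ω_k`
      ∀ {HVd : Domains (F.P K)}
        (_ : HVd = domainsMeet (cubeDomains (F.P K) (cornerP (F.P K) Mc ρ idx) (sideP (F.P K) Mc ρ) ρ (K - n) hk) (domainsOfSeq s.Ω (K - n) hk))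
        (lo hi : ℕ → Pt (F.P K).d),
      lo 0 = (fun i => ((F.P K).L : ℤ) * (sqLo (F.P K).L (cornerP (F.P K) Mc ρ idx) ρ (K - n) 1 i - 1)) →
      hi 0 = (fun i => ((F.P K).L : ℤ) * (sqHi (F.P K).L (cornerP (F.P K) Mc ρ idx) (sideP (F.P K) Mc ρ) ρ (K - n) 1 i + 1) + (((F.P K).L : ℤ) - 1)) →
      (∀ j', 1 ≤ j' → lo j' = sqLo (F.P K).L (cornerP (F.P K) Mc ρ idx) ρ (K - n) j' - 1) →
      (∀ j', 1 ≤ j' → hi j' = sqHi (F.P K).L (cornerP (F.P K) Mc ρ idx) (sideP (F.P K) Mc ρ) ρ (K - n) j' + 1) →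
      ∀ (u : GaugeTransf (F.P K) 0 (SU N)) (A : PBond (F.P K) 0 → MatA N),
      (∀ b ∈ (Sect2.regionOfSet (F.P K) (cover (F.P K) '' box (F.P K).L (cornerP (F.P K) Mc ρ idx) (sideP (F.P K) Mc ρ) (K - n))).bonds,
        gaugeU (fun x => ιSU N (u x)) (fun b' => ιSU N (U b')) b = expI ((F.P K).eta (K - n)) (A b)) →
      -- (T1) the gauge equation on the WHOLE TOWER `□₀` of the datum
      (∀ b ∈ (Sect2.regionOfSet (F.P K) (cover (F.P K) '' cube (F.P K).L (cornerP (F.P K) Mc ρ idx) (sideP (F.P K) Mc ρ) ρ (K - n) 0)).bonds,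
        gaugeU (fun x => ιSU N (u x)) (fun b' => ιSU N (U b')) b = expI ((F.P K).eta (K - n)) (A b)) →
      -- (T2) (152)'s LEVEL-WEIGHTED letters on every `□_{j′}`, `j′ ≤ K − n`
      (∀ j', j' ≤ K - n →
        ∀ b ∈ (Sect2.regionOfSet (F.P K) (cover (F.P K) '' cube (F.P K).L (cornerP (F.P K) Mc ρ idx) (sideP (F.P K) Mc ρ) ρ (K - n) j')).bonds,
          ‖A b‖ < κ * ε (K - n) * ((F.P K).L : ℝ) ^ (K - n - j')) →
      (∀ b ∈ (Sect2.regionOfSet (F.P K) (cover (F.P K) '' box (F.P K).L (cornerP (F.P K) Mc ρ idx) (sideP (F.P K) Mc ρ) (K - n))).bonds,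
        ‖A b‖ < κ * ε (K - n)) →
      (∀ q ∈ (Sect2.regionOfSet (F.P K) (cover (F.P K) '' box (F.P K).L (cornerP (F.P K) Mc ρ idx) (sideP (F.P K) Mc ρ) (K - n))).dpairs,
        ‖grad ((F.P K).eta (K - n)) q.2.1 (fun y => A ⟨y, q.2.2⟩) q.1‖ < κ * ε (K - n)) →
      (∀ b ∈ Sect2.bondsDeep (cover (F.P K) '' box (F.P K).L (cornerP (F.P K) Mc ρ idx) (sideP (F.P K) Mc ρ) (K - n)),
        ‖Sect2.codiffCurlA ((F.P K).eta (K - n)) A b.src b.dir‖ < κ * ε (K - n)) →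
      (∀ b ∈ Sect2.bondsDeep (cover (F.P K) '' box (F.P K).L (cornerP (F.P K) Mc ρ idx) (sideP (F.P K) Mc ρ) (K - n)),
        ‖∑ ν' : Fin (F.P K).d, (((F.P K).eta (K - n) : ℝ) : ℂ)⁻¹ •
            (grad ((F.P K).eta (K - n)) ν' (fun y => A ⟨y, b.dir⟩) (b.src.unshift ν') - grad ((F.P K).eta (K - n)) ν' (fun y => A ⟨y, b.dir⟩) b.src)‖ <
          κ * ε (K - n)) →
      (∀ D' : Domains (F.P K), LinearMap.ker (QpE D') ≤ LinearMap.ker (QpE HVd) → ∀ φ : MatA N →L[ℂ] ℂ,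
        RE D' ((F.P K).eta (K - n))⁻¹ (dsE ((F.P K).eta (K - n))⁻¹ (WithLp.toLp 2 fun b => (φ (A b)).re : BondSpace (F.P K))) = 0 ∧
        RE D' ((F.P K).eta (K - n))⁻¹ (dsE ((F.P K).eta (K - n))⁻¹ (WithLp.toLp 2 fun b => (φ (A b)).im : BondSpace (F.P K))) = 0) →
      -- ★ THE NORMALISATION of this `u` (print's «ū_j = 1 on Λ′_j»), as delivered by HS3NORM
      NrmSymPhiOfRecord F N Mc ρ (Ψ ε (K - n)) ν M g K k s U (K - n) idx u A →
      ∀ c : BondIdx HVd, ((c.1.1 : ℕ) = K - n ∨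
          (blockOf c.1.2.src ∈ (cubeDomains (F.P K) (cornerP (F.P K) Mc ρ idx) (sideP (F.P K) Mc ρ) ρ (K - n) hk).Om ((c.1.1 : ℕ) + 1) ∧
            blockOf c.1.2.tgt ∈ (cubeDomains (F.P K) (cornerP (F.P K) Mc ρ idx) (sideP (F.P K) Mc ρ) ρ (K - n) hk).Om ((c.1.1 : ℕ) + 1))) →
        ‖bondAvgIter (c.1.1 : ℕ) A c.1.2‖ ≤ (fun (ε δ : ℕ → ℝ) (j : ℕ) => (F.L : ℝ) * (2 * ((((4 - 1 : ℕ) : ℝ) * ((crad (ρ * ((Mc + 11 * 4) / ρ + 2)) ρ : ℕ) : ℝ) * (1 + 2 * (((F.L : ℝ) ^ 2 + 6 * (((4 + 2) * F.L : ℕ) : ℝ) ^ 2) * (4 * (((4 - 1 : ℕ) : ℝ) * ((2 * F.L - 1 : ℕ) : ℝ)) + 1))) + 14 * ((((4 + 2) * F.L : ℕ) : ℝ) ^ 2 / 4 * (4 * (((4 - 1 : ℕ) : ℝ) * ((2 * F.L - 1 : ℕ) : ℝ)) + 1)) + 2 * (((4 + 1) * (F.L - 1) : ℕ) : ℝ)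 * ((((14 * (4 * ((F.L - 1) / 2)) + 1 : ℕ) : ℝ)) * (((4 - 1 : ℕ) : ℝ) * ((F.L - 1 : ℕ) : ℝ)))) * δ j + ((100 * (240 * (((4 + 2) * F.L : ℕ) : ℝ) ^ 2 * (κ * ε j * (F.L : ℝ))) ^ 2 + 6 * Ψ ε j + 100 * (240 * (((4 + 2) * F.L : ℕ) : ℝ) ^ 2 * (κ * ε j * (F.L : ℝ))) ^ 2 * (6 * Ψ ε j)) + (100 * (240 * (((4 + 2) * F.L : ℕ) : ℝ) ^ 2 * (κ * ε j * (F.L : ℝ))) ^ 2 + 6 * Ψ ε j + 100 * (240 * (((4 + 2) * F.L : ℕ) : ℝ) ^ 2 * (κ * ε j * (F.L : ℝ))) ^ 2 * (6 * Ψ ε j)) + (100 * (240 * (((4 + 2) * F.L : ℕ) : ℝ) ^ 2 * (κ * ε j * (F.L : ℝ))) ^ 2 + 6 * Ψ ε j + 100 * (240 * (((4 + 2) * F.L : ℕ) : ℝ) ^ 2 * (κ * ε j * (F.L : ℝ))) ^ 2 * (6 * Ψ ε j)) * (100 * (240 * (((4 + 2) * F.L : ℕ) : ℝ) ^ 2 *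 (κ * ε j * (F.L : ℝ))) ^ 2 + 6 * Ψ ε j + 100 * (240 * (((4 + 2) * F.L : ℕ) : ℝ) ^ 2 * (κ * ε j * (F.L : ℝ))) ^ 2 * (6 * Ψ ε j))) * (1 + (((4 - 1 : ℕ) : ℝ) * ((crad (ρ * ((Mc + 11 * 4) / ρ + 2)) ρ : ℕ) : ℝ) * (1 + 2 * (((F.L : ℝ) ^ 2 + 6 * (((4 + 2) * F.L : ℕ) : ℝ) ^ 2) * (4 * (((4 - 1 : ℕ) : ℝ) * ((2 * F.L - 1 : ℕ) : ℝ)) + 1))) + 14 * ((((4 + 2) * F.L : ℕ) : ℝ) ^ 2 / 4 * (4 * (((4 - 1 : ℕ) : ℝ) * ((2 * F.L - 1 : ℕ) : ℝ)) + 1)) + 2 * (((4 + 1) * (F.L - 1) : ℕ) : ℝ) * ((((14 * (4 * ((F.L - 1) / 2)) + 1 : ℕ) : ℝ)) * (((4 - 1 : ℕ) : ℝ) * ((F.L - 1 : ℕ) : ℝ)))) * δ j)) + 64 * 60800 * (((4 + 2) * F.L : ℕ) : ℝ) ^ 2 * (κ * ε j * (F.L : ℝ)) ^ 2)) ε δ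 (K - n) := by
  intro ν M g K k s hsep hM₁ hadm hk1 ε δ hδ hcompδ hcompδ' hε hεc hεc' W h7 U h17 h19 hfib hcrit n hk hk1' hjk idx hmeet hclean HVd hHVd lo hi hlo0 hhi0 hloj hhij
    u A hbox hT1 hT2 hAbox hgrad hcodiff hcurl hLandau hN cI hnear
  subst hHVd
  -- the guard's consequences
  obtain ⟨hcM, hlev⟩ := hAdm₁ ν M g K k s hadm
  have hgrid2 := hAdm₂ ν M g K k s hadm
  have hPd : (F.P K).d = 4 := rfl
  have hPL : (F.P K).L = F.L := rfl
  have hPm : (F.P K).m = F.m := rfl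
  have hPK : (F.P K).K = K := rfl
  have hL1 : 1 ≤ F.L := by have := F.hL11; omega
  have hkK : k ≤ (F.P K).m + (F.P K).K := by rw [hPm, hPK]; omega
  have hgrid : ∀ j : ℕ, 1 ≤ j → j ≤ k → dCubeSide (F.P K).L M (RkOfRecord (F.P K).L ν.r (g j)) j ∣ (F.P K).sitesPerDir 0 := fun j h1 hj => (hgrid2 j h1 hj).2
  have hρ1 : 1 ≤ ρ := le_trans hL1 hLρ
  have hLρ' : (F.P K).L ≤ ρ := by rw [hPL]; exact hLρ
  have hfloor : (11 * (F.P K).d + 4 * ρ + Mc) * (F.P K).L + 3 ≤ ν.M₁ := by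
    rw [hPd, hPL]
    have e : (11 * 4 + 4 * ρ + Mc + 3) * F.L = (11 * 4 + 4 * ρ + Mc) * F.L + 3 * F.L := by ring
    have h3 : 3 ≤ 3 * F.L := by omega
    omega
  have hjK : K - n + 1 ≤ (F.P K).m + (F.P K).K := by rw [hPm, hPK]; omega
  -- the window's non-wrapping from the level guard
  have hside : sideP (F.P K) Mc ρ ≤ Mc + 11 * 4 + 2 * ρ := by
    unfold sideP; rw [hPd, Nat.mul_add]
    have := Nat.mul_div_le (Mc + 11 * 4) ρ
    omega
  have h2pow : 2 * (F.P K).L ^ c₀ ≤ (F.P K).sitesPerDir (K - n) := two_mul_pow_le_sitesPerDir_of_levelGuard (P := F.P K) hjk (by rw [hPm, hPK]; exact hlev)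
  have hn : ∀ κ', (tHi (cornerP (F.P K) Mc ρ idx) (sideP (F.P K) Mc ρ) ρ) κ' ≤ (tLo (cornerP (F.P K) Mc ρ idx) ρ) κ' + (sideP (F.P K) Mc ρ + 4 * ρ - 1 : ℕ) := by
    intro κ'
    have hS1 : 1 ≤ sideP (F.P K) Mc ρ := by have := le_sideP (P := F.P K) Mc hρ1; omega
    simp only [tHi, tLo]
    omega
  have hnN : (sideP (F.P K) Mc ρ + 4 * ρ - 1 : ℕ) + 1 < (F.P K).sitesPerDir (K - n) := by
    rw [hPL] at h2pow; omega
  -- `Adm22 D″ R (L·M_h)` (the NON-widened named instance with the datum's grid numerics)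
  have hnum := numerics_cornerP_of_levelGuard F (Mc := Mc) hk1' hjk hlev hMha (by omega) hLρ' hdvd (by omega) idx
  obtain ⟨ha, hM, hper, -⟩ := hnum
  have hLMh : 1 ≤ F.L * Mh := by
    rw [hMha]; exact Nat.one_le_iff_ne_zero.mpr (Nat.mul_ne_zero (by omega) (pow_ne_zero _ (by omega)))
  have hν1 : 1 ≤ ν.M₁ := hM₁
  have hRsep : R * (F.L * Mh) + 1 ≤ (F.P K).L * ν.M₁ := by
    rw [hPL]
    have h1 : ν.M₁ ≤ F.L * ν.M₁ := Nat.le_mul_of_pos_left _ hL1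
    have h2 : ρ + 1 ≤ c := by
      have : 11 * 4 + 4 * ρ + Mc + 3 ≤ (11 * 4 + 4 * ρ + Mc + 3) * F.L := Nat.le_mul_of_pos_right _ hL1
      omega
    omega
  have hgran : ∀ j' : ℕ, 1 ≤ j' → j' ≤ K - n → F.L * Mh ∣ M * RkOfRecord (F.P K).L ν.r (g j') := fun j' h1 hj' => (hgrid2 j' h1 (hj'.trans hjk)).1
  have hdiv : ∀ j' : ℕ, 1 ≤ j' → j' ≤ K - n → dCubeSide (F.P K).L M (RkOfRecord (F.P K).L ν.r (g j')) j' ∣ (F.P K).sitesPerDir 0 :=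
    fun j' h1 hj' => hgrid j' h1 (hj'.trans hjk)
  have hAdmD := adm22_meetCube_trunc_seqOfRecord F ν M g K k s hjk hk hLMh hν1 hRsep hsep hdiv hgran hdvd ha hM hper hRρ
  have hRM' : 2 * (F.P K).L ≤ R * (F.L * Mh) + 1 := by rw [hPL]; exact hRM
  -- the letters at the datum's level
  have hδj : 0 < δ (K - n) := (hδ (K - n) hjk).1
  have hεj0 : 0 ≤ ε (K - n) := le_trans (by positivity : 0 ≤ B₃ * δ (K - n)) (hε (K - n) hjk).1
  have hεa : ε (K - n) ≤ a₀ := (hε (K - n) hjk).2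
  have hℓ0 : (0 : ℝ) ≤ (((4 + 2) * F.L : ℕ) : ℝ) := Nat.cast_nonneg _
  have hsm : κ * ε (K - n) * (F.L : ℝ) ≤ κ * a₀ * (F.L : ℝ) :=
    mul_le_mul_of_nonneg_right (mul_le_mul_of_nonneg_left hεa hκ) (Nat.cast_nonneg _)
  have hsm0 : 0 ≤ κ * ε (K - n) * (F.L : ℝ) := by positivity
  have hbud : 243200 * ((((F.P K).d + 2) * (F.P K).L : ℕ) : ℝ) ^ 2 * (κ * ε (K - n) * ((F.P K).L : ℝ)) ≤ 1 := by
    rw [hPd, hPL]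
    exact (mul_le_mul_of_nonneg_left hsm (by positivity)).trans ha₀bud
  have hgd : 60 * ((((F.P K).d + 2) * (F.P K).L : ℕ) : ℝ) ^ 2 * (κ * ε (K - n) * ((F.P K).L : ℝ)) < deltaSU (Fin N) := by
    rw [hPd, hPL]
    exact lt_of_le_of_lt (mul_le_mul_of_nonneg_left hsm (by positivity)) ha₀gd
  have hσF : 5760 * ((((F.P K).d + 2) * (F.P K).L : ℕ) : ℝ) ^ 2 * (κ * ε (K - n) * ((F.P K).L : ℝ)) < deltaFed (Fin N) := by
    rw [hPd, hPL]
    exact lt_of_le_of_lt (mul_le_mul_of_nonneg_left hsm (by positivity)) ha₀σF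
  have hσS : 2880 * ((((F.P K).d + 2) * (F.P K).L : ℕ) : ℝ) ^ 2 * (κ * ε (K - n) * ((F.P K).L : ℝ)) < deltaSU (Fin N) := by
    rw [hPd, hPL]
    exact lt_of_le_of_lt (mul_le_mul_of_nonneg_left hsm (by positivity)) ha₀σS
  have hσ4 : 240 * ((((F.P K).d + 2) * (F.P K).L : ℕ) : ℝ) ^ 2 * (κ * ε (K - n) * ((F.P K).L : ℝ)) ≤ 1 / 10000 := by
    rw [hPd, hPL]
    exact (mul_le_mul_of_nonneg_left hsm (by positivity)).trans ha₀σ4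
  -- the defect's guards at the datum's level
  obtain ⟨hψ0, hψ, hXj⟩ := hΨ ε (K - n) hεj0 hεa
  have hX' : ((((F.P K).d - 1 : ℕ) : ℝ) * ((crad (sideP (F.P K) Mc ρ) ρ : ℕ) : ℝ) * (1 + 2 * ((((F.P K).L : ℝ) ^ 2 + 6 * ((((F.P K).d + 2) * (F.P K).L : ℕ) : ℝ) ^ 2) * (4 * ((((F.P K).d - 1 : ℕ) : ℝ) * ((2 * (F.P K).L - 1 : ℕ) : ℝ)) + 1))) + 14 * (((((F.P K).d + 2) * (F.P K).L : ℕ) : ℝ) ^ 2 / 4 * (4 * ((((F.P K).d - 1 : ℕ) : ℝ) * ((2 * (F.P K).L - 1 : ℕ) : ℝ)) + 1)) + 2 * ((((F.P K).d + 1) * ((F.P K).L - 1) : ℕ) : ℝ) * ((((14 * ((F.P K).d * (((F.P K).L - 1) / 2)) + 1 : ℕ) : ℝ)) * ((((F.P K).d - 1 : ℕ) : ℝ) * (((F.P K).L - 1 : ℕ) : ℝ)))) * a₁ +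
      2 * ((100 * (240 * ((((F.P K).d + 2) * (F.P K).L : ℕ) : ℝ) ^ 2 * (κ * ε (K - n) * ((F.P K).L : ℝ))) ^ 2 + 6 * Ψ ε (K - n) + 100 * (240 * ((((F.P K).d + 2) * (F.P K).L : ℕ) : ℝ) ^ 2 * (κ * ε (K - n) * ((F.P K).L : ℝ))) ^ 2 * (6 * Ψ ε (K - n))) + (100 * (240 * ((((F.P K).d + 2) * (F.P K).L : ℕ) : ℝ) ^ 2 * (κ * ε (K - n) * ((F.P K).L : ℝ))) ^ 2 + 6 * Ψ ε (K - n) + 100 * (240 * ((((F.P K).d + 2) * (F.P K).L : ℕ) : ℝ) ^ 2 * (κ * ε (K - n) * ((F.P K).L : ℝ))) ^ 2 * (6 * Ψ ε (K - n))) + (100 * (240 * ((((F.P K).d + 2) * (F.P K).L : ℕ) : ℝ) ^ 2 * (κ * ε (K - n) * ((F.P K).L : ℝ))) ^ 2 + 6 * Ψ ε (K - n) + 100 * (240 * ((((F.P K).d + 2) * (F.P K).L : ℕ) : ℝ) ^ 2 * (κ * ε (K - n) * ((F.P K).L : ℝ))) ^ 2 * (6 * Ψ ε (K - n))) * (100 *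 (240 * ((((F.P K).d + 2) * (F.P K).L : ℕ) : ℝ) ^ 2 * (κ * ε (K - n) * ((F.P K).L : ℝ))) ^ 2 + 6 * Ψ ε (K - n) + 100 * (240 * ((((F.P K).d + 2) * (F.P K).L : ℕ) : ℝ) ^ 2 * (κ * ε (K - n) * ((F.P K).L : ℝ))) ^ 2 * (6 * Ψ ε (K - n)))) ≤ 1 / 2 := by
    rw [hPd, hPL]; unfold sideP; rw [hPd]
    exact hXj
  -- MODULE 98′ at the datum
  have h98 := norm_bondAvgIter_le_of_near_symPhiB F N s hsep hkK hgrid hMc hρ1 hLρ' hfloor hδ hcompδ (by rw [hPd, hPL]; exact hguard) (by rw [hPd, hPL]; exact hguardF)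
    W h7 U hfib hk1' hjk hjK idx hmeet hclean hn hnN u A hκ hεj0 hT1 hT2 hbud hgd hσF hσS hσ4 hk hψ0 hψ hN hAdmD hRM' hX' cI hnear
  refine h98.trans (le_of_eq ?_)
  simp only [hPd, hPL, sideP]

end Record

end Summit.QuantumFields.YangMills.BalabanUVNodes.N07SymHQnearPhiEB

end
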